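import Summits.ABC.IUTFork.Cor312LicenceWildExactCells
import Summits.ABC.IUTFork.Cor312LicenceTameExactRealising
import HarnessLib

/-!
# [IUTchIII] Cor. 3.12 — the (xi-f) LICENCE at the sharp real settings DECIDED EXACTLY at fibres of ARBITRARY local type:
# per packet `(j, p)` and per datum, ONE closed ∀-form predicate in the inner/outer radii of the factor log-shells and the differents

PROOF-ONLY file (D-0012; 0 definitions, 0 `Prop` facts) of the abc-iut cell — D-0079 RESCUE sub-cell R-W «WINDOW Θ-SIDE INEQUALITY»,
lane U, row «U2-LICENCE-WRAPPER» (ruling C-R30 2026-08-26T14:20:36Z), seat abc-iut-w4-d036 gen 7; part 2 over `Cor312LicenceWildExactCells`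
(the UPPER/LOWER legs). TAKES NO SIDE on [IUTchIII] Cor. 3.12 (S. Mochizuki, *Inter-universal Teichmüller theory III*, kurims manuscript,
Cor. 3.12 p. 173 l. 41 – p. 174 l. 19; Step (xi-f) p. 184 l. 26–29; Thm. 3.11 (i) (Ind1)(Ind2) p. 154) or on any author: every statement is
about OUR typed objects (abc-iut-c312-3/c312-7's sharp real settings `settingDHVolSharp` / `settingPrVolSharp`, abc-iut-c312-5's `presAt` and
typed (Ind1)(Ind2) `logShellsDH`, abc-iut-c312-1's `Thm311ToCor312.Licence`, branch C's `QPinned ∧ PilotKummerCompatHull`); the hull-level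
licence is a STRONGER-THAN-PRINT reading of Step (xi-f) (ADJUDICATION-SPEC §2 (G1′)); nothing here bears on the printed GLOBAL inequality or
the number-level corollary. typed ≠ proved; instantiated ≠ endorsed; refuted-as-typed ≠ refuted-in-print.

BINDERS (abc-iut-c312-5's convention, STATUS 2026-08-26T16:22:10Z, per prime `p` and place `x | p` of `F`, in the presented completion
`(presAt X hlog p).k x = F_x`): INNER radius `cin p x` with `hin0`/`hin` (`cin·𝒪 ⊆ log_p(𝒪^×)`) and maximality `hmax` (some `w ∉ log_p(𝒪^×)` with
`‖w‖·‖ϖ_x‖ ≤ ‖cin‖`); OUTER radius `cout p x` with `hout0`/`houtΛ` (`cout ∈ log_p(𝒪^×)`)/`hdom` (largest norm). `‖cin‖ = ‖ϖ_x‖^{r_in(x)}`,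
`‖cout‖ = ‖ϖ_x‖^{r_out(x)}` — the integers of abc-iut-s2-p12's U2-LATTICE-INTEGERS / abc-iut-c312-3's closed forms (`UnitLogMaxNorm`,
`innerRadius_closedForm`); tame: `r_in = r_out = 1`.

WHAT IS PROVED (namespace `Summit.ABC.IUTFork.Thm311.Real`).
* §3 **`qRegion_subset_thetaHull_settingDHVolSharp_iff_shellRadii`** — THE EXACT CELL at `(j, p)`, any prime (wild, `p = 2`), any label,
  Θ-ideles `t ≠ 0`: `q-region ⊆ ⁿ˚𝒰_{j,p}` **iff** for every summand `v⃗` SOME slot `σ(last)` satisfies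
  `∀ m, (∀ J, p^m·‖t_{Θ,j,v_{σ(last)}}‖ ≤ p^{−(d_I − d_{L_J})}·∏_a ‖cin v_a‖) → p^m·‖t_{q,v_j}‖ ≤ ∏_a ‖cout v_a‖`, i.e.
  `v_p(t_{q,v_j}) + Σ_a β(v_a) ≥ ⌊min_a v_p(t_{Θ,j,v_a}) − (d_I − min_J d_{L_J}) − Σ_a α(v_a)⌋` (the SHALLOWEST Θ-idele of the tuple decides,
  by the (Ind1) capsule permutations; the q-radius is read at the last slot).
* §4 **`licence_settingDHVolSharp_iff_shellRadii`**, **`licence_settingPrVolSharp_iff_shellRadii`** — abc-iut-c312-1's `Thm311ToCor312.Licence`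
  ⟺ the cells at every `(i+1, p)`; **`exists_qPinned_and_hull_settingPrVolSharp_iff_shellRadii`** — branch C's per-datum antecedent
  «∃ ρ qK, QPinned ∧ PilotKummerCompatHull» (any columns; q-ideles of norm `≤ 1`) ⟺ the same — the wild generalisation of abc-iut-w5-d009's
  `licence_settingPrVolSharp_iff_of_realises_tame` / `exists_qPinned_and_hull_settingPrVolSharp_iff_of_realises_tame` (there `α = β = 1/e`
  and the predicate is `e·((j²P_w − 1) div e) + 1 − j(e−1) ≤ P_w`).
READING (neutral; numbers, not adjectives): in OUR typed containers the per-datum S_H / (xi-f)-licence question at a NON-TAME bad fibre is no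
longer open-ended: it is the displayed predicate, whose only field inputs are `(e(x|p), d_x, r_in(x), r_out(x))` per place and the norms of the
realising ideles (`‖t_{Θ,j,w}‖ = p^{−j²P_q(w)/e_w}`, `‖t_{q,w}‖ = p^{−P_q(w)/e_w}`, Dupuy–Hilado (3.4)). HONEST SCOPE: OUR sharp containers
(Θ-regions constant in `m`) and Dupuy–Hilado's typed (Ind1)/(Ind2) acting independently on every (capsule slot, place); STRONGER-THAN-PRINT
hull reading; nothing about the author's intended hull, the M-level `Ism`, the printed GLOBAL inequality, or the existence of initial Θ-data;
no side taken on [IUTchIII] Cor. 3.12. [cite: Mochizuki2012, IUTchIII Cor. 3.12 p. 173–175, Step (xi) (xi-d)(xi-f) p. 183–184, Thm. 3.11 (i)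
p. 154; IUTchIV Prop. 1.1 p. 9, Prop. 1.2 (i)(ii) p. 10] [cite: DupuyHilado2025, §3.4, §3.9, §4.7, §4.9, §4.12] [cite: WeilBNT1967, Ch. II §2,
Th. 1–2] [claim: Mochizuki2012, status: disputed] for every IUT sentence quoted.
-/

noncomputable section

open Set Function
open scoped Pointwise TensorProduct

/-! ## §3. THE EXACT CELL at `(j, p)` in inner/outer-radius binders (abc-iut-c312-5's convention) -/

namespace Summit.ABC.IUTFork.Thm311.Real

open Cor312 Cor312.Setting Cor312Vol Cor312Vol.ExplicitDepth Literature.IUT.LogThetaLattice Literature.IUT.LogVolume NumberField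
  IsDedekindDomain
open Literature.NumberTheory.GaloisRepresentations.Ultrametric

variable {F : Type} [Field F] [NumberField F] (X : PilotData F) {logv : PadicLogs F} (hlog : LogvAnalytic logv)
  (M : Type) [Field M] [NumberField M]
  (archPk : ∀ (j : (thetaIndex X).Label) (vQ : (thetaIndex X).VQ), Set ((logShellsDH X logv).Packet j vQ))
  (archSub : ∀ (j : (thetaIndex X).Label) (v : (thetaIndex X).V),
    Set ((logShellsDH X logv).Packet j ((thetaIndex X).over v)))
  (Ψ : ℤ → ∀ v : (thetaIndex X).V, v ∈ (thetaIndex X).Vbad → Set ((logShellsDH X logv).StarPacket v))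
  (act : ℤ → ∀ v : (thetaIndex X).V, v ∈ (thetaIndex X).Vbad →
    (logShellsDH X logv).StarPacket v → Module.End ℚ ((logShellsDH X logv).StarPacket v))
  (Mmod : ℤ → ∀ j : (thetaIndex X).LabelStar, Set ((logShellsDH X logv).GlobalPacket j.1))
  (region : ℤ → ∀ j : (thetaIndex X).LabelStar, FinDivisor M → ∀ vQ : (thetaIndex X).VQ,
    Set ((logShellsDH X logv).Packet j.1 vQ))
  (n : ℤ) {HT : Type} {LogLink : HT → HT → Type} {IsFull : ∀ {s t : HT}, LogLink s t → Prop}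
  (lat : LGPGaussianLogThetaLattice LogLink IsFull)
  {Frd : Type} {IsoF : Frd → Frd → Type} {Ob : Frd → Type} {realify : Frd → Frd} {Strip : Type}
  {IsoS : Strip → Strip → Type} {Mv : ∀ v : (thetaIndex X).V, v ∈ (thetaIndex X).Vbad → Type}
  [∀ v h, Monoid (Mv v h)]
  (sig : GlobalLGPFrobenioidSignature (thetaIndex X).lstar (thetaIndex X).V (· ∈ (thetaIndex X).Vbad)
    Frd IsoF Ob realify Strip IsoS Mv)
  (split : SplittingMonoids Mv) {ObΔ : Type} {N : ∀ v : (thetaIndex X).V, v ∈ (thetaIndex X).Vbad → Type}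
  [∀ v h, Monoid (N v h)] (qData : QPilotData ObΔ N)
  (tq : ∀ (pp : Nat.Primes) (x : (thetaIndex X).Fibre (.inr pp)), haveI : Fact (pp : ℕ).Prime := ⟨pp.2⟩; kOf X pp.1 x)
  (t : ∀ (pp : Nat.Primes) (_ : Fin X.lstar) (x : (thetaIndex X).Fibre (.inr pp)),
    haveI : Fact (pp : ℕ).Prime := ⟨pp.2⟩; kOf X pp.1 x)
  (htq0 : ∀ pp x, tq pp x ≠ 0)
  (htq1 : ∀ (pp : Nat.Primes) (x : (thetaIndex X).Fibre (.inr pp)),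
    haveI : Fact (pp : ℕ).Prime := ⟨pp.2⟩; placeOf X pp.1 x ∉ X.S → ‖tq pp x‖ = 1)

section OnePrime

variable (pp : Nat.Primes) [Fact (pp : ℕ).Prime]

/-- **THE EXACT (xi-f) CELL AT `(j, p)`, ANY LOCAL TYPE.** Θ-ideles `t ≠ 0`; at every place `x | p` of `F` an INNER radius `cin x`
(`cin x·𝒪 ⊆ log_p(𝒪^×_{F_x})`, maximal: some `w ∉ log_p(𝒪^×)` with `‖w‖·‖ϖ_x‖ ≤ ‖cin x‖`) and an OUTER radius `cout x ∈ log_p(𝒪^×_{F_x})` of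
largest norm (abc-iut-c312-5's binders). THEN the q-pilot region at `(j, p)` lies in the holomorphic hull `ⁿ˚𝒰_{j,p}` of the union of the
possible images of the Θ-pilot region **iff** for every summand `v⃗` SOME slot `σ(last)` satisfies
`∀ m ∈ ℤ, (∀ J, p^m·‖t_{Θ,j,v_{σ(last)}}‖ ≤ p^{−(d_I − d_{L_J})}·∏_a ‖cin v_a‖) → p^m·‖t_{q,v_j}‖ ≤ ∏_a ‖cout v_a‖`
— i.e. `v_p(t_{q,v_j}) + Σ_a β(v_a) ≥ ⌊min_a v_p(t_{Θ,j,v_a}) − (d_I − min_J d_{L_J}) − Σ_a α(v_a)⌋` with `‖cin‖ = p^{−α}`, `‖cout‖ = p^{−β}`: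
the wild generalisation of abc-iut-w4-d006's tame per-packet dichotomy (`α = β = 1/e`). (⇐): abc-iut-c312-5's factorwise cell
`iota_smul_subset_packetHull_factorwiseOrbit_iota_smul_iff` + part 1's LOWER leg + abc-iut-rp-d1's criterion; (⇒): at the slot of LARGEST
Θ-radius every slot's box has at least that content (c312-5 `iota_smul_normalizedPacket_subset_zpow_smul_logPacket_iff`) and part 1's UPPER leg
refutes. [cite: Mochizuki2012, IUTchIII Cor. 3.12 Step (xi-f) p. 184; Thm. 3.11 (i) p. 154; IUTchIV Prop. 1.1 p. 9, Prop. 1.2 (i)(ii) p. 10]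
[cite: DupuyHilado2025, §3.9, §4.7, §4.9, §4.12] [claim: Mochizuki2012, status: disputed] -/
theorem qRegion_subset_thetaHull_settingDHVolSharp_iff_shellRadii (ht0 : ∀ pp i x, t pp i x ≠ 0) (j : (thetaIndex X).Label)
    {cin cout : ∀ x : (thetaIndex X).Fibre (.inr pp), (presAt X hlog pp).k x} (hin0 : ∀ x, cin x ≠ 0)
    (hin : ∀ x (o : (presAt X hlog pp).k x), ‖o‖ ≤ 1 → cin x * o ∈ logUnits ((presAt X hlog pp).k x))
    (hmax : ∀ x, ∃ (ϖ : ((presAt X hlog pp).k x)ˣ) (w : (presAt X hlog pp).k x),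
      IsUniformizer ϖ ∧ w ∉ logUnits ((presAt X hlog pp).k x) ∧ ‖w‖ * ‖(ϖ : (presAt X hlog pp).k x)‖ ≤ ‖cin x‖)
    (hout0 : ∀ x, cout x ≠ 0) (houtΛ : ∀ x, cout x ∈ logUnits ((presAt X hlog pp).k x))
    (hdom : ∀ x, ∀ z ∈ logUnits ((presAt X hlog pp).k x), ‖z‖ ≤ ‖cout x‖) :
    (settingDHVolSharp X hlog M archPk archSub Ψ act Mmod region n lat sig split qData tq t htq0 htq1).qRegion j (.inr pp) ⊆
        (settingDHVolSharp X hlog M archPk archSub Ψ act Mmod region n lat sig split qData tq t htq0 htq1).thetaHull j (.inr pp) ↔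
      ∀ e : (thetaIndex X).Caps j → (thetaIndex X).Fibre (.inr pp), ∃ σ : Equiv.Perm ((thetaIndex X).Caps j), ∀ m : ℤ,
        (∀ J : DIdx (pp : ℕ) ((presAt X hlog pp).kk e),
            ((pp : ℕ) : ℝ) ^ m * ‖labelIdele X t pp j (e (σ (Fin.last _)))‖ ≤
              ((pp : ℕ) : ℝ) ^ (-(dSum (pp : ℕ) ((presAt X hlog pp).kk e) -
                differentOrd (pp : ℕ) (DFac (pp : ℕ) ((presAt X hlog pp).kk e) J))) * ∏ a, ‖cin (e a)‖) →
          ((pp : ℕ) : ℝ) ^ m * ‖tq pp (e (Fin.last _))‖ ≤ ∏ a, ‖cout (e a)‖ := by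
  classical
  haveI : Nonempty ((thetaIndex X).Caps j) := ⟨0⟩
  have hp0 : (0 : ℝ) < ((pp : ℕ) : ℝ) := by exact_mod_cast pp.2.pos
  constructor
  · intro hcell e
    by_contra hne
    push Not at hne
    -- the slot of LARGEST Θ-radius
    obtain ⟨σ₀, hσ₀⟩ := Finite.exists_max fun σ : Equiv.Perm ((thetaIndex X).Caps j) =>
      ‖labelIdele X t pp j (e (σ (Fin.last _)))‖
    obtain ⟨m, hC, hD⟩ := hne σ₀
    -- every slot's box has content at least `m`
    have hbox : ∀ σ : Equiv.Perm ((thetaIndex X).Caps j),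
        iota (pp : ℕ) ((presAt X hlog pp).kk e) (σ (Fin.last _)) (labelIdele X t pp j (e (σ (Fin.last _)))) •
            (normalizedPacket (pp : ℕ) ((presAt X hlog pp).kk e) : Set ((presAt X hlog pp).X e)) ⊆
          ((pp : ℕ) : ℚ_[pp]) ^ m • (logPacket (pp : ℕ) ((presAt X hlog pp).kk e) : Set ((presAt X hlog pp).X e)) := by
      intro σ
      refine (iota_smul_normalizedPacket_subset_zpow_smul_logPacket_iff (pp : ℕ) ((presAt X hlog pp).kk e)
        (c := fun a => cin (e a)) (fun a => hin0 (e a)) (fun a => hin (e a)) (fun a => hmax (e a)) (σ (Fin.last _))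
        (labelIdele X t pp j (e (σ (Fin.last _)))) m).mpr fun J => ?_
      exact (mul_le_mul_of_nonneg_left (hσ₀ σ) (zpow_nonneg hp0.le _)).trans (hC J)
    have hlt : ((pp : ℕ) : ℝ) ^ (-m) * ∏ a, ‖cout (e a)‖ < ‖tq pp (e (Fin.last _))‖ := by
      have h := mul_lt_mul_of_pos_left hD (zpow_pos hp0 (-m))
      rwa [← mul_assoc, ← zpow_add₀ hp0.ne', neg_add_cancel, zpow_zero, one_mul] at h
    exact not_qRegion_subset_thetaHull_settingDHVolSharp_of_forall_box_subset X hlog M archPk archSub Ψ act Mmod region n lat sig split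
      qData tq t htq0 htq1 pp ht0 j e hout0 houtΛ hdom m hbox hlt hcell
  · intro h
    refine (qRegion_subset_thetaHull_settingDHVolSharp_iff_exists_image X hlog M archPk archSub Ψ act Mmod region n lat sig split qData
      tq t htq0 htq1 ht0 pp j).2 fun e i => ?_
    obtain ⟨σ, hσ⟩ := h e
    have hq := (iota_smul_subset_packetHull_factorwiseOrbit_iota_smul_iff (pp : ℕ) ((presAt X hlog pp).kk e)
      (cin := fun a => cin (e a)) (cout := fun a => cout (e a)) (fun a => hin0 (e a)) (fun a => hin (e a))
      (fun a => hmax (e a)) (fun a => hout0 (e a)) (fun a => houtΛ (e a)) (fun a => hdom (e a)) (σ (Fin.last _)) (Fin.last _)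
      (labelIdele_ne_zero X t ht0 pp j (e (σ (Fin.last _)))) (tq pp (e (Fin.last _)))).mpr hσ
    exact exists_mem_sUnion_possibleImages_norm_ge_of_subset_packetHull X hlog M archPk archSub Ψ act Mmod region n lat sig split qData
      tq t htq0 htq1 pp j e σ hq i

end OnePrime

/-! ## §4. The LICENCE and branch C's antecedent at the sharp settings, fibres of arbitrary local type -/

/-- **THE (xi-f) LICENCE AT `settingDHVolSharp` ⟺ the exact cells at every `(i+1, p)`** (Θ-ideles `t ≠ 0`; per prime `p` and place `x | p`
inner/outer shell radii `cin p x`, `cout p x` as in §3; archimedean cells are unconditional — empty factor index). With `t_{Θ,i+1,x} = t p i x`: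
`Licence ⟺ ∀ p, ∀ i, ∀ v⃗, ∃ σ, ∀ m, (∀ J, p^m·‖t_{Θ,i+1,v_{σ(last)}}‖ ≤ p^{−(d_I − d_{L_J})}·∏_a ‖cin v_a‖) → p^m·‖t_{q,v_{last}}‖ ≤ ∏_a ‖cout v_a‖`.
At a prime whose fibre is uniformly tame this is abc-iut-w4-d006 / w5-d009's integer predicate (`α = β = 1/e`); at wild and dyadic fibres
the two radii differ and both enter (abc-iut-c312-5 T2-EXACT-CONTENT; the per-type values of `(cin, cout)` are abc-iut-s2-p12's
U2-LATTICE-INTEGERS / abc-iut-c312-3's closed forms). [cite: Mochizuki2012, IUTchIII Cor. 3.12 Step (xi-f) p. 184; IUTchIV Prop. 1.2 (i)(ii) p. 10]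
[cite: DupuyHilado2025, §3.9, §4.9, §4.12] [claim: Mochizuki2012, status: disputed] -/
theorem licence_settingDHVolSharp_iff_shellRadii (ht0 : ∀ pp i x, t pp i x ≠ 0)
    (cin cout : ∀ (pp : Nat.Primes) (x : (thetaIndex X).Fibre (.inr pp)),
      haveI : Fact (pp : ℕ).Prime := ⟨pp.2⟩; (presAt X hlog pp).k x)
    (hin0 : ∀ pp x, cin pp x ≠ 0)
    (hin : ∀ (pp : Nat.Primes) (x : (thetaIndex X).Fibre (.inr pp)), haveI : Fact (pp : ℕ).Prime := ⟨pp.2⟩;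
      ∀ o : (presAt X hlog pp).k x, ‖o‖ ≤ 1 → cin pp x * o ∈ logUnits ((presAt X hlog pp).k x))
    (hmax : ∀ (pp : Nat.Primes) (x : (thetaIndex X).Fibre (.inr pp)), haveI : Fact (pp : ℕ).Prime := ⟨pp.2⟩;
      ∃ (ϖ : ((presAt X hlog pp).k x)ˣ) (w : (presAt X hlog pp).k x),
        IsUniformizer ϖ ∧ w ∉ logUnits ((presAt X hlog pp).k x) ∧ ‖w‖ * ‖(ϖ : (presAt X hlog pp).k x)‖ ≤ ‖cin pp x‖)
    (hout0 : ∀ pp x, cout pp x ≠ 0)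
    (houtΛ : ∀ (pp : Nat.Primes) (x : (thetaIndex X).Fibre (.inr pp)), haveI : Fact (pp : ℕ).Prime := ⟨pp.2⟩;
      cout pp x ∈ logUnits ((presAt X hlog pp).k x))
    (hdom : ∀ (pp : Nat.Primes) (x : (thetaIndex X).Fibre (.inr pp)), haveI : Fact (pp : ℕ).Prime := ⟨pp.2⟩;
      ∀ z ∈ logUnits ((presAt X hlog pp).k x), ‖z‖ ≤ ‖cout pp x‖) :
    Thm311ToCor312.Licence (settingDHVolSharp X hlog M archPk archSub Ψ act Mmod region n lat sig split qData tq t htq0 htq1) ↔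
      ∀ (pp : Nat.Primes) (i : Fin (thetaIndex X).lstar)
        (e : (thetaIndex X).Caps (Setting.labelSucc i) → (thetaIndex X).Fibre (.inr pp)),
        haveI : Fact (pp : ℕ).Prime := ⟨pp.2⟩
        ∃ σ : Equiv.Perm ((thetaIndex X).Caps (Setting.labelSucc i)), ∀ m : ℤ,
          (∀ J : DIdx (pp : ℕ) ((presAt X hlog pp).kk e),
              ((pp : ℕ) : ℝ) ^ m * ‖t pp i (e (σ (Fin.last _)))‖ ≤
                ((pp : ℕ) : ℝ) ^ (-(dSum (pp : ℕ) ((presAt X hlog pp).kk e) -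
                  differentOrd (pp : ℕ) (DFac (pp : ℕ) ((presAt X hlog pp).kk e) J))) * ∏ a, ‖cin pp (e a)‖) →
            ((pp : ℕ) : ℝ) ^ m * ‖tq pp (e (Fin.last _))‖ ≤ ∏ a, ‖cout pp (e a)‖ := by
  constructor
  · intro hL pp i e
    haveI : Fact (pp : ℕ).Prime := ⟨pp.2⟩
    have hcell := hL i (.inr pp)
    obtain ⟨σ, hσ⟩ := (qRegion_subset_thetaHull_settingDHVolSharp_iff_shellRadii X hlog M archPk archSub Ψ act Mmod region n lat sig
      split qData tq t htq0 htq1 pp ht0 (Setting.labelSucc i) (hin0 pp) (hin pp) (hmax pp) (hout0 pp) (houtΛ pp) (hdom pp)).1 hcell e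
    refine ⟨σ, fun m hm => hσ m fun J => ?_⟩
    rw [labelIdele_labelSucc]
    exact hm J
  · intro h i vQ
    cases vQ with
    | inl u =>
      show factorMapDH X hlog (Setting.labelSucc i) (.inl u) ⁻¹'
          hullSet (factorFieldDH X hlog (Setting.labelSucc i) (.inl u)) (qCentreDH X hlog tq (Setting.labelSucc i) (.inl u)) ⊆
        (HullFrame.ofComparison (factorFieldDH X hlog (Setting.labelSucc i) (.inl u))
          (factorMapDH X hlog (Setting.labelSucc i) (.inl u))).hull
          (⋃₀ (settingDHVolSharp X hlog M archPk archSub Ψ act Mmod region n lat sig split qData tq t htq0 htq1).possibleImages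
            (Setting.labelSucc i) (.inl u))
      exact HullFrame.preimage_hullSet_subset_hull_ofComparison _ _ _ _ fun s => s.elim
    | inr pp =>
      haveI : Fact (pp : ℕ).Prime := ⟨pp.2⟩
      refine (qRegion_subset_thetaHull_settingDHVolSharp_iff_shellRadii X hlog M archPk archSub Ψ act Mmod region n lat sig split qData
        tq t htq0 htq1 pp ht0 (Setting.labelSucc i) (hin0 pp) (hin pp) (hmax pp) (hout0 pp) (houtΛ pp) (hdom pp)).2 fun e => ?_
      obtain ⟨σ, hσ⟩ := h pp i e
      refine ⟨σ, fun m hm => hσ m fun J => ?_⟩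
      rw [← labelIdele_labelSucc X t pp i]
      exact hm J

/-- **The same at the print-normalised setting `settingPrVolSharp`** (abc-iut-c312-7; the bed of the window certificates' `hSHw`;
`licence_settingPrVolSharp_iff_settingDHVolSharp`). [cite: DupuyHilado2025, §3.9, §4.9] [claim: Mochizuki2012, status: disputed] -/
theorem licence_settingPrVolSharp_iff_shellRadii (ht0 : ∀ pp i x, t pp i x ≠ 0)
    (cin cout : ∀ (pp : Nat.Primes) (x : (thetaIndex X).Fibre (.inr pp)),
      haveI : Fact (pp : ℕ).Prime := ⟨pp.2⟩; (presAt X hlog pp).k x)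
    (hin0 : ∀ pp x, cin pp x ≠ 0)
    (hin : ∀ (pp : Nat.Primes) (x : (thetaIndex X).Fibre (.inr pp)), haveI : Fact (pp : ℕ).Prime := ⟨pp.2⟩;
      ∀ o : (presAt X hlog pp).k x, ‖o‖ ≤ 1 → cin pp x * o ∈ logUnits ((presAt X hlog pp).k x))
    (hmax : ∀ (pp : Nat.Primes) (x : (thetaIndex X).Fibre (.inr pp)), haveI : Fact (pp : ℕ).Prime := ⟨pp.2⟩;
      ∃ (ϖ : ((presAt X hlog pp).k x)ˣ) (w : (presAt X hlog pp).k x),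
        IsUniformizer ϖ ∧ w ∉ logUnits ((presAt X hlog pp).k x) ∧ ‖w‖ * ‖(ϖ : (presAt X hlog pp).k x)‖ ≤ ‖cin pp x‖)
    (hout0 : ∀ pp x, cout pp x ≠ 0)
    (houtΛ : ∀ (pp : Nat.Primes) (x : (thetaIndex X).Fibre (.inr pp)), haveI : Fact (pp : ℕ).Prime := ⟨pp.2⟩;
      cout pp x ∈ logUnits ((presAt X hlog pp).k x))
    (hdom : ∀ (pp : Nat.Primes) (x : (thetaIndex X).Fibre (.inr pp)), haveI : Fact (pp : ℕ).Prime := ⟨pp.2⟩;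
      ∀ z ∈ logUnits ((presAt X hlog pp).k x), ‖z‖ ≤ ‖cout pp x‖) :
    Thm311ToCor312.Licence (settingPrVolSharp X hlog M archPk archSub Ψ act Mmod region n lat sig split qData tq t htq0 htq1) ↔
      ∀ (pp : Nat.Primes) (i : Fin (thetaIndex X).lstar)
        (e : (thetaIndex X).Caps (Setting.labelSucc i) → (thetaIndex X).Fibre (.inr pp)),
        haveI : Fact (pp : ℕ).Prime := ⟨pp.2⟩
        ∃ σ : Equiv.Perm ((thetaIndex X).Caps (Setting.labelSucc i)), ∀ m : ℤ,
          (∀ J : DIdx (pp : ℕ) ((presAt X hlog pp).kk e),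
              ((pp : ℕ) : ℝ) ^ m * ‖t pp i (e (σ (Fin.last _)))‖ ≤
                ((pp : ℕ) : ℝ) ^ (-(dSum (pp : ℕ) ((presAt X hlog pp).kk e) -
                  differentOrd (pp : ℕ) (DFac (pp : ℕ) ((presAt X hlog pp).kk e) J))) * ∏ a, ‖cin pp (e a)‖) →
            ((pp : ℕ) : ℝ) ^ m * ‖tq pp (e (Fin.last _))‖ ≤ ∏ a, ‖cout pp (e a)‖ := by
  rw [licence_settingPrVolSharp_iff_settingDHVolSharp]
  exact licence_settingDHVolSharp_iff_shellRadii X hlog M archPk archSub Ψ act Mmod region n lat sig split qData tq t htq0 htq1 ht0 cin cout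
    hin0 hin hmax hout0 houtΛ hdom

/-- **BRANCH C's PER-DATUM ANTECEDENT «∃ ρ qK, QPinned ∧ PilotKummerCompatHull» at `settingPrVolSharp` ⟺ the exact cells** (any columns
`col`; q-ideles of norm `≤ 1` — true for realising ideles; abc-iut-w5-d009's `exists_qPinned_and_hull_settingPrVolSharp_iff_licence`). This is
the `hSHw`-shaped binder of the window certificates of record, decided per datum by the per-place shell radii at the bad fibres of ARBITRARY
local type. [cite: Mochizuki2012, IUTchIII Cor. 3.12 Step (xi-d) p. 183, (xi-f) p. 184] [cite: DupuyHilado2025, §3.9, §4.9]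
[claim: Mochizuki2012, status: disputed] -/
theorem exists_qPinned_and_hull_settingPrVolSharp_iff_shellRadii (ht0 : ∀ pp i x, t pp i x ≠ 0) (htqle : ∀ pp x, ‖tq pp x‖ ≤ 1)
    (col : ℤ → Column (logShellsDH X logv))
    (cin cout : ∀ (pp : Nat.Primes) (x : (thetaIndex X).Fibre (.inr pp)),
      haveI : Fact (pp : ℕ).Prime := ⟨pp.2⟩; (presAt X hlog pp).k x)
    (hin0 : ∀ pp x, cin pp x ≠ 0)
    (hin : ∀ (pp : Nat.Primes) (x : (thetaIndex X).Fibre (.inr pp)), haveI : Fact (pp : ℕ).Prime := ⟨pp.2⟩;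
      ∀ o : (presAt X hlog pp).k x, ‖o‖ ≤ 1 → cin pp x * o ∈ logUnits ((presAt X hlog pp).k x))
    (hmax : ∀ (pp : Nat.Primes) (x : (thetaIndex X).Fibre (.inr pp)), haveI : Fact (pp : ℕ).Prime := ⟨pp.2⟩;
      ∃ (ϖ : ((presAt X hlog pp).k x)ˣ) (w : (presAt X hlog pp).k x),
        IsUniformizer ϖ ∧ w ∉ logUnits ((presAt X hlog pp).k x) ∧ ‖w‖ * ‖(ϖ : (presAt X hlog pp).k x)‖ ≤ ‖cin pp x‖)
    (hout0 : ∀ pp x, cout pp x ≠ 0)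
    (houtΛ : ∀ (pp : Nat.Primes) (x : (thetaIndex X).Fibre (.inr pp)), haveI : Fact (pp : ℕ).Prime := ⟨pp.2⟩;
      cout pp x ∈ logUnits ((presAt X hlog pp).k x))
    (hdom : ∀ (pp : Nat.Primes) (x : (thetaIndex X).Fibre (.inr pp)), haveI : Fact (pp : ℕ).Prime := ⟨pp.2⟩;
      ∀ z ∈ logUnits ((presAt X hlog pp).k x), ‖z‖ ≤ ‖cout pp x‖) :
    (∃ (ρ : (∀ v : (thetaIndex X).V, v ∈ (thetaIndex X).Vbad → Set ((logShellsDH X logv).StarPacket v)) →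
          ∀ (j : (thetaIndex X).Label) (vQ : (thetaIndex X).VQ), Set ((logShellsDH X logv).Packet j vQ))
        (qK : ∀ v : (thetaIndex X).V, v ∈ (thetaIndex X).Vbad → Set ((logShellsDH X logv).StarPacket v)),
        QPinned ({ toSituation := situationPrVol X hlog M archPk archSub Ψ act Mmod region, col := col } :
            LatticeSituation (thetaIndex X))
          (settingPrVolSharp X hlog M archPk archSub Ψ act Mmod region n lat sig split qData tq t htq0 htq1) ρ qK ∧
        PilotKummerCompatHull ({ toSituation := situationPrVol X hlog M archPk archSub Ψ act Mmod region, col := col } :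
            LatticeSituation (thetaIndex X))
          (settingPrVolSharp X hlog M archPk archSub Ψ act Mmod region n lat sig split qData tq t htq0 htq1) ρ qK) ↔
      ∀ (pp : Nat.Primes) (i : Fin (thetaIndex X).lstar)
        (e : (thetaIndex X).Caps (Setting.labelSucc i) → (thetaIndex X).Fibre (.inr pp)),
        haveI : Fact (pp : ℕ).Prime := ⟨pp.2⟩
        ∃ σ : Equiv.Perm ((thetaIndex X).Caps (Setting.labelSucc i)), ∀ m : ℤ,
          (∀ J : DIdx (pp : ℕ) ((presAt X hlog pp).kk e),
              ((pp : ℕ) : ℝ) ^ m * ‖t pp i (e (σ (Fin.last _)))‖ ≤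
                ((pp : ℕ) : ℝ) ^ (-(dSum (pp : ℕ) ((presAt X hlog pp).kk e) -
                  differentOrd (pp : ℕ) (DFac (pp : ℕ) ((presAt X hlog pp).kk e) J))) * ∏ a, ‖cin pp (e a)‖) →
            ((pp : ℕ) : ℝ) ^ m * ‖tq pp (e (Fin.last _))‖ ≤ ∏ a, ‖cout pp (e a)‖ := by
  rw [exists_qPinned_and_hull_settingPrVolSharp_iff_licence X hlog M archPk archSub Ψ act Mmod region n lat sig split qData tq t htq0
    htq1 col htqle]
  exact licence_settingPrVolSharp_iff_shellRadii X hlog M archPk archSub Ψ act Mmod region n lat sig split qData tq t htq0 htq1 ht0 cin cout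
    hin0 hin hmax hout0 houtΛ hdom

end Summit.ABC.IUTFork.Thm311.Real

end
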